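import Summits.BirchSwinnertonDyer.Rank1Residual.X9.PrintCertTamagawaDoors
import Summits.BirchSwinnertonDyer.BirchSwinnertonDyer.Theorems.PrintX9CertImageKernel
import Literature.NumberTheory.EllipticCurves.MatarNekovar2019.IrreducibleOverQuadraticFieldProofs
import Literature.NumberTheory.EllipticCurves.NeronIsogenyScalingHoldsProofs
import HarnessLib

/-!
# Leaves X9 / X10b — the J-FREE doors of `X9/PrintCertTamagawaDoors.lean` on a certified record with the
# image certificate IN THE KERNEL and two print binders DISCHARGED (companion; cell `bsd-print-x9`,
# seat `bsd-print-x9-p1`)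

HONEST FRAMING (D-0131 (2) print tier; partition leaf `ClassX9`): theorems only; no named fact; nothing
booked; no leaf closed (`BSDpOnClassX9` stays open). `X9/PrintCertTamagawaDoors.lean` (records v2) gives,
for every certified X9 record with `r.rank = 1 → ¬ r.p ∣ r.tamagawa` (694 of the 790 pairs: the 375 of
rank `0` and the 319 of rank `1` off the Tamagawa line), the leaf's print shape `PPartBSD W p` for ANY
globally minimal elliptic `W` with the record's integral model, WITHOUT crux J, from rung K6's two items
`KatoMuTransfer` (19629) ∧ `AnalyticMuZeroOnClassX9` (19630) — or from the typed engine
`IntegralMainConjectureOnClassX9` — plus the published binders of p4's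
`X9.bsdp_of_x9IntegralMainConjecture_of_heegnerRoad`, the five Zywina `j`-line facts (door `…_of_jLines`)
and the record's CLAIMS. Since records v2 three kinds of those hypotheses have become THEOREMS of the tree:
* the five `j`-line facts (`Record.not_surj_of_check_kernel`, `Theorems/PrintX9CertImageKernel.lean`:
  `¬Surj W p` in the kernel for every certified record);
* Matar–Nekovář 2019 Prop. 5.26 (2) (`MatarNekovar2019.prop526_hasIrreducibleModPGaloisRep_baseChange_holds`);
* the Néron-scaling integrality of a globally minimal model
  (`integral_neronScaling_of_isGloballyMinimal_holds`).
This file re-exports the two doors with those binders SUPPLIED. What remains is exactly the doors' tier: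
the K6 items `h1 h2` (resp. the typed engine `hIMC`), the PUBLISHED facts `hGZ hKo hMN h124a h331 hGr hGZK
hmodL hmodP hnf hHL hMaz h5` verbatim, and ONE claim of the record — its analytic rank `hrank`.
References: [BurungaleCastellaSkinner2025] Thm. 1.1.2 (a), Cor. 1.3.1; [Zywina2015] Thm. 1.2, 1.4, 1.5;
[MatarNekovar2019] Prop. 5.26 (2); [Silverman1994] IV.9.4.
-/

set_option autoImplicit false

noncomputable section

open scoped Classical

open WeierstrassCurve Literature.NumberTheory.EllipticCurves Literature.NumberTheory.EllipticCurves.Rank1Residual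
  Literature.NumberTheory.EllipticCurves.ModularForms
  Literature.NumberTheory.EllipticCurves.BurungaleCastellaSkinner2025
  Literature.NumberTheory.EllipticCurves.JetchevSkinnerWan2017
  Summit.BirchSwinnertonDyer.BirchSwinnertonDyer.Theorems.Rank1ResidualX1Defs
  Summit.BirchSwinnertonDyer.BirchSwinnertonDyer.Rank1Residual
  Summit.BirchSwinnertonDyer.BirchSwinnertonDyer.Rank1Residual.IntModel

namespace Summit.BirchSwinnertonDyer.Rank1Residual.X9.PrintCert

namespace Record

variable (r : Record) {W : WeierstrassCurve ℚ} [W.IsElliptic] [W.IsGloballyMinimal]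
  (hI : integralModelInt W = r.intCurve)
include hI

/-- **The J-free door from the typed engine, image certificate IN THE KERNEL**: as
`Record.pPartBSD_of_check_of_tamCheck_of_imc`, with `¬Surj W p` read from the record's image certificate by
`Record.not_surj_of_check_kernel` (no `j`-line fact), and the binders `h526` (Matar–Nekovář Prop. 5.26 (2))
and `hNS` (Néron scaling of a globally minimal model) supplied by their tree theorems. The ONLY claim left
is the analytic rank `hrank`. [cite: BurungaleCastellaSkinner2025, Cor. 1.3.1 and its proof (p. 4)]
[cite: Zywina2015, Thm. 1.4 (ii), 1.5 (ii)] [cite: MatarNekovar2019, Prop. 5.26 (2)] -/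
theorem pPartBSD_of_check_of_tamCheck_of_imc_kernel
    (hGZ : ∀ (N : ℕ) [NeZero N] (W : WeierstrassCurve ℚ) (K : Type) [Field K] [NumberField K],
      gross_zagier N W K)
    (hKo : ∀ (N : ℕ) [NeZero N] (W : WeierstrassCurve ℚ) (K : Type) [Field K] [NumberField K],
      kolyvagin N W K)
    (hMN : ∀ (N : ℕ) [NeZero N] (W : WeierstrassCurve ℚ) (K : Type) [Field K] [NumberField K],
      MatarNekovar2019.thm03_padicValNat_card_sha_le_of_irreducible N W K)
    (h124a : thm124a_prop422_thm513_generator_constantCoeff)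
    (h331 : thm331_anticyclotomicControl)
    (hGr : greenberg_charValue_rankZero) (hGZK : rank_eq_analyticRank_of_analyticRank_le_one)
    (hmodL : hasEntireLFunction_rat) (hmodP : nonempty_modularParametrizationData)
    (hnf : exists_isNewformOf) (hHL : HoffsteinLuo1997_exists_twist_L_one_ne_zero)
    (hMaz : mazur_not_dvd_maninConstant_of_odd) (h5 : realPeriodRat_eq_unit_mul_plusPeriod)
    (hIMC : IntegralMainConjectureOnClassX9)
    (hc : r.check = true) (hsome : r.imageCert.isSome = true) {c : TamCert} (htc : r.tamCheck c = true)
    (hvac : r.rank = 1 → ¬ r.p ∣ r.tamagawa) {q : ℕ} [Fact q.Prime] (hq : q = r.p) (hp5 : 5 ≤ q)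
    (hrank : W.analyticRank = r.rank) : PPartBSD W q :=
  r.pPartBSD_of_check_of_tamCheck_of_imc hI hGZ hKo hMN
    MatarNekovar2019.prop526_hasIrreducibleModPGaloisRep_baseChange_holds h124a h331 hGr hGZK hmodL hmodP
    hnf hHL hMaz integral_neronScaling_of_isGloballyMinimal_holds h5 hIMC hc htc hvac hq hp5
    (r.not_surj_of_check_kernel hI hc hsome hq) hrank

/-- **The J-free door from rung K6's two items, image certificate IN THE KERNEL**: as
`Record.pPartBSD_of_check_of_tamCheck_of_jLines` (19629 ∧ 19630 through
`integralMainConjectureOnClassX9_of_katoMuTransfer` and BCS 2025 Thm. 1.1.2 (a)), with the five Zywina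
`j`-line facts, Matar–Nekovář Prop. 5.26 (2) and the Néron-scaling integrality supplied by their tree
theorems: the ONLY claim left is the analytic rank `hrank`.
[cite: BurungaleCastellaSkinner2025, Thm. 1.1.2 (a), Cor. 1.3.1] [cite: Kato2004Asterisque, Thm. 12.5, 17.4]
[cite: Zywina2015, Thm. 1.4 (ii), 1.5 (ii)] [cite: MatarNekovar2019, Prop. 5.26 (2)] -/
theorem pPartBSD_of_check_of_tamCheck_kernel
    (hGZ : ∀ (N : ℕ) [NeZero N] (W : WeierstrassCurve ℚ) (K : Type) [Field K] [NumberField K],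
      gross_zagier N W K)
    (hKo : ∀ (N : ℕ) [NeZero N] (W : WeierstrassCurve ℚ) (K : Type) [Field K] [NumberField K],
      kolyvagin N W K)
    (hMN : ∀ (N : ℕ) [NeZero N] (W : WeierstrassCurve ℚ) (K : Type) [Field K] [NumberField K],
      MatarNekovar2019.thm03_padicValNat_card_sha_le_of_irreducible N W K)
    (h124a : thm124a_prop422_thm513_generator_constantCoeff)
    (h331 : thm331_anticyclotomicControl)
    (hBCS : burungale_castella_skinner_charIdeal_eq_padicLFunction)
    (hGr : greenberg_charValue_rankZero) (hGZK : rank_eq_analyticRank_of_analyticRank_le_one)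
    (hmodL : hasEntireLFunction_rat) (hmodP : nonempty_modularParametrizationData)
    (hnf : exists_isNewformOf) (hHL : HoffsteinLuo1997_exists_twist_L_one_ne_zero)
    (hMaz : mazur_not_dvd_maninConstant_of_odd) (h5 : realPeriodRat_eq_unit_mul_plusPeriod)
    (h1 : KatoMuTransfer) (h2 : AnalyticMuZeroOnClassX9)
    (hc : r.check = true) (hsome : r.imageCert.isSome = true) {c : TamCert} (htc : r.tamCheck c = true)
    (hvac : r.rank = 1 → ¬ r.p ∣ r.tamagawa) {q : ℕ} [Fact q.Prime] (hq : q = r.p) (hp5 : 5 ≤ q)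
    (hrank : W.analyticRank = r.rank) : PPartBSD W q :=
  r.pPartBSD_of_check_of_tamCheck hI hGZ hKo hMN
    MatarNekovar2019.prop526_hasIrreducibleModPGaloisRep_baseChange_holds h124a h331 hBCS hGr hGZK hmodL
    hmodP hnf hHL hMaz integral_neronScaling_of_isGloballyMinimal_holds h5 h1 h2 hc htc hvac hq hp5
    (r.not_surj_of_check_kernel hI hc hsome hq) hrank

end Record

end Summit.BirchSwinnertonDyer.Rank1Residual.X9.PrintCert

end
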